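import Mathlib
import Summits.MatrixMultiplication.MatrixMultiplication.Theorems.SnSubsetDichotomyPolynomialSlackCertificateMixedBlocks
import Summits.MatrixMultiplication.MatrixMultiplication.Theorems.SnSubsetDichotomyPolynomialSlackReversedTriple

/-!
# The four entropy costs of the 3/4 step, certified

Crux `Summit.MatrixMultiplication.MatrixMultiplication.Theses.SnSubsetDichotomy.PolynomialSlack`
(item `stmt-MatrixMultiplication-8306`), level-one programme, line transport-split-hull (lead c10).
In the assembly of the 3/4 step the per-row bound `rows_kept_le` is used twice: for the hub ROWS
`k ∈ R` of the original triple `(S, T, U)` (T-levels of the column `d_B(·,k)`, masked S-levels of the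
row `d_C(k,·)` avoiding the hub columns `Q`), and for the hub COLUMNS `i ∈ Q`, i.e. the rows of the
reversed triple `(U, T, S)` (T-levels of the row `d_A(i,·)`, unmasked S-levels of the column
`d_C(·,i)`).  Its right-hand side carries four ENTROPY COSTS, each of the form
`∑_{included levels} mass · (1 − log width / log n)`.  This file bounds their sum:

`(costs) · log n ≤ log K_A + log K_B + log K_C + (included mass) · log ((2|R| + 2|Q| + 2)/ε₁) + 6`,

`K_A = n!/(|S||T|)`, `K_B = n!/(|T||U|)`, `K_C = n!/(|U||S|)`, by three certificate calls:
`certificate_levels` for the pair `(T, U)` at the positions `R` (T-costs of the rows),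
`certificate_levels` for the pair `(T, S)` at the positions `Q` (T-costs of the columns; the profile
of `(T, S)` is the transpose of `d_A`, `reversed_profiles`), and `certificate_mixed_blocks` on the
quotient set `S⁻¹U` with the masked row blocks at `R` and the column blocks at `Q` (both S-costs at
once; the mask makes the row blocks avoid the values `Q`).  The included masses are kept visible
(linearly) so that the assembly can bootstrap them against the rate bounds of the included levels;
inside the logarithm they are bounded crudely by `2|R| + 2|Q| + 2` (unit row and column sums of the
three profiles).

* `costs_certified` — the registered stub (included mass visible in the junk term);
* `costs_certified_with_mass` — the same together with `0 ≤ (included mass) ≤ 2|R| + 2|Q|`;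
* `costs_certified_crude` — the closed form of the junk, `(2|R|+2|Q|+2) log ((2|R|+2|Q|+2)/ε₁) + 6`,
  for `ε₁ ≤ 1`.

The level type `Fin m` is arbitrary (the programme uses `m = ⌊log₂ n²⌋ + 1`); `Ψ, Ψc` and `ε₂` only
enter through the inclusion predicates and are unconstrained.
-/

namespace Summit.MatrixMultiplication.MatrixMultiplication.Theorems.PolynomialSlack

open scoped BigOperators
open Literature.Combinatorics.Additive (TripleProductProperty)

set_option linter.dupNamespace false

/-! ## Small bookkeeping lemmas -/

-- adapted from …HubAtomsArith (`hubAtoms_mul_log_le_of_le`)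
/-- `s log (s/ε) ≤ s log (M/ε)` for `0 ≤ s ≤ M`. -/
private theorem costs_mul_log_le_of_le {s M ε : ℝ} (hs0 : 0 ≤ s) (hs : s ≤ M) (hε : 0 < ε) :
    s * Real.log (s / ε) ≤ s * Real.log (M / ε) := by
  rcases eq_or_lt_of_le hs0 with h0 | hpos
  · rw [← h0]; simp
  · exact mul_le_mul_of_nonneg_left
      (Real.log_le_log (by positivity) (div_le_div_of_nonneg_right hs hε.le)) hs0

/-- Summing a non-negative function over blocks that pairwise share no element gives at most the
full sum. -/
private theorem costs_sum_blocks_le {ι : Type*} [Fintype ι] {m : ℕ} (f : ι → ℝ) (hf : ∀ j, 0 ≤ f j)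
    (B : Fin m → Finset ι) (hB : ∀ a b, ∀ j ∈ B a, j ∈ B b → a = b) :
    ∑ a, ∑ j ∈ B a, f j ≤ ∑ j, f j := by
  classical
  have hdisj : Set.PairwiseDisjoint (↑(Finset.univ : Finset (Fin m))) B := fun a _ b _ hab =>
    Finset.disjoint_left.2 fun j hja hjb => hab (hB a b j hja hjb)
  rw [← Finset.sum_biUnion hdisj]
  exact Finset.sum_le_sum_of_subset_of_nonneg (Finset.subset_univ _) fun j _ _ => hf j

/-- The positions of a family of atoms drawn from `R ×ˢ univ` lie in `R`. -/
private theorem costs_card_image_fst_le {α β : Type*} [DecidableEq α] (R : Finset α)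
    (I : Finset (α × β)) (h : ∀ p ∈ I, p.1 ∈ R) : (I.image Prod.fst).card ≤ R.card :=
  Finset.card_le_card (Finset.image_subset_iff.2 h)

/-- A cost sum `∑_{k ∈ R} ∑_a [P k a] f k a (1 - g k a / L)` times `L ≠ 0` is the atom sum
`∑_{(k,a) ∈ (R × univ) ∩ P} f (L - g)`. -/
private theorem costs_sum_ite_mul {α β : Type*} [Fintype β] (R : Finset α) (P : α → β → Prop)
    [∀ k a, Decidable (P k a)] (f g : α → β → ℝ) {L : ℝ} (hL : L ≠ 0) :
    (∑ k ∈ R, ∑ a, if P k a then f k a * (1 - g k a / L) else 0) * L =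
      ∑ p ∈ (R ×ˢ Finset.univ).filter (fun p => P p.1 p.2), f p.1 p.2 * (L - g p.1 p.2) := by
  rw [Finset.sum_filter, Finset.sum_product, Finset.sum_mul]
  refine Finset.sum_congr rfl fun k _ => ?_
  rw [Finset.sum_mul]
  refine Finset.sum_congr rfl fun a _ => ?_
  split_ifs
  · rw [mul_assoc, sub_mul, one_mul, div_mul_cancel₀ _ hL]
  · rw [zero_mul]

/-- A mass sum `∑_{k ∈ R} ∑_a [P k a] f k a` is the atom sum `∑_{(k,a) ∈ (R × univ) ∩ P} f`. -/
private theorem costs_sum_ite {α β : Type*} [Fintype β] (R : Finset α) (P : α → β → Prop)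
    [∀ k a, Decidable (P k a)] (f : α → β → ℝ) :
    (∑ k ∈ R, ∑ a, if P k a then f k a else 0) =
      ∑ p ∈ (R ×ˢ Finset.univ).filter (fun p => P p.1 p.2), f p.1 p.2 := by
  rw [Finset.sum_filter, Finset.sum_product]

/-- An atom sum of a non-negative `f` over atoms drawn from `R ×ˢ univ` is at most `|R|` when the
level sums `∑_a f k a` are at most `1`. -/
private theorem costs_atom_sum_le_card {α β : Type*} [Fintype β] (R : Finset α) (I : Finset (α × β))
    (hI : I ⊆ R ×ˢ Finset.univ) (f : α → β → ℝ) (hf : ∀ k a, 0 ≤ f k a) (h1 : ∀ k, ∑ a, f k a ≤ 1) :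
    ∑ p ∈ I, f p.1 p.2 ≤ R.card := by
  calc ∑ p ∈ I, f p.1 p.2 ≤ ∑ p ∈ R ×ˢ Finset.univ, f p.1 p.2 :=
        Finset.sum_le_sum_of_subset_of_nonneg hI fun p _ _ => hf p.1 p.2
    _ = ∑ k ∈ R, ∑ a, f k a := Finset.sum_product _ _ _
    _ ≤ ∑ k ∈ R, (1 : ℝ) := Finset.sum_le_sum fun k _ => h1 k
    _ = R.card := by rw [Finset.sum_const, nsmul_eq_mul, mul_one]

/-! ## The stub -/

/-- **The four entropy costs, with the bounds on the included mass.**  The inequality of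
`costs_certified` (below) together with `0 ≤ (included mass) ≤ 2|R| + 2|Q|` (unit row and column
sums of the three profiles); one application gives the assembly everything it needs for the
bootstrap of the included mass against the rate bounds. [folklore] -/
theorem costs_certified_with_mass {n m : ℕ} (hn : 2 ≤ n) {S T U : Finset (Equiv.Perm (Fin n))} (hTPP : TripleProductProperty S T U) (hS0 : S.Nonempty) (hT0 : T.Nonempty) (hU0 : U.Nonempty) (dA dB dC pB pC pBc : Fin n → Fin n → ℝ) (hdA : ∀ i j, dA i j = (((S ×ˢ T).filter fun st => st.2 j = st.1 i).card : ℝ) / (S.card * T.card : ℕ)) (hdB : ∀ j k, dB j k = (((T ×ˢ U).filter fun tu => tu.2 k = tu.1 j).card : ℝ) / (T.card * U.card : ℕ)) (hdC : ∀ k i, dC k i = (((U ×ˢ S).filter fun us => us.2 i = us.1 k).card : ℝ) / (U.card * S.card : ℕ)) (θC : ℝ) (hpB : ∀ j k, pB j k = if 16 / (n : ℝ) ≤ dB j k then dB j k - 1 / n else 0) (hpC : ∀ k i, pC k i = if θC ≤ dC k i then dC k i - 1 / n else 0) (hpBc : ∀ j i, pBc j i = if 16 / (n : ℝ) ≤ dA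 i j then dA i j - 1 / n else 0) (ε₁ ε₂ : ℝ) (hε₁ : 0 < ε₁) (R Q : Finset (Fin n)) (hRQ : 2 * ((R.card : ℝ) + Q.card) ^ 2 ≤ n) (σ σ' x ρ ρ' y : Fin n → Fin m → ℝ) (hσ : ∀ k a, σ k a = ∑ j ∈ Finset.univ.filter (fun j => 16 / (n : ℝ) ≤ dB j k ∧ ⌊Real.logb 2 (1 / dB j k)⌋₊ = a.val), pB j k) (hσ' : ∀ k a, σ' k a = ∑ j ∈ Finset.univ.filter (fun j => 16 / (n : ℝ) ≤ dB j k ∧ ⌊Real.logb 2 (1 / dB j k)⌋₊ = a.val), dB j k) (hx : ∀ k a, x k a = max (((Finset.univ.filter (fun j => 16 / (n : ℝ) ≤ dB j k ∧ ⌊Real.logb 2 (1 / dB j k)⌋₊ = a.val)).card : ℝ)) 1) (hρ : ∀ k b, ρ k b = ∑ i ∈ Finset.univ.filter (fun i => i ∉ Q ∧ θC ≤ dC k i ∧ ⌊Real.logb 2 (1 / dC k i)⌋₊ = b.val), pC k i) (hρ' : ∀ k b, ρ' k b = ∑ i ∈ Finset.univ.filter (fun i => i ∉ Q ∧ θC ≤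 dC k i ∧ ⌊Real.logb 2 (1 / dC k i)⌋₊ = b.val), dC k i) (hy : ∀ k b, y k b = max (((Finset.univ.filter (fun i => i ∉ Q ∧ θC ≤ dC k i ∧ ⌊Real.logb 2 (1 / dC k i)⌋₊ = b.val)).card : ℝ)) 1) (Ψ : Fin n → Fin m → Fin m → ℝ) (σc σc' xc ρc ρc' yc : Fin n → Fin m → ℝ) (hσc : ∀ i a, σc i a = ∑ j ∈ Finset.univ.filter (fun j => 16 / (n : ℝ) ≤ dA i j ∧ ⌊Real.logb 2 (1 / dA i j)⌋₊ = a.val), pBc j i) (hσc' : ∀ i a, σc' i a = ∑ j ∈ Finset.univ.filter (fun j => 16 / (n : ℝ) ≤ dA i j ∧ ⌊Real.logb 2 (1 / dA i j)⌋₊ = a.val), dA i j) (hxc : ∀ i a, xc i a = max (((Finset.univ.filter (fun j => 16 / (n : ℝ) ≤ dA i j ∧ ⌊Real.logb 2 (1 / dA i j)⌋₊ = a.val)).card : ℝ)) 1) (hρc : ∀ i b, ρc i b = ∑ k ∈ Finset.univ.filter (fun k => k ∉ (∅ : Finset (Fin n)) ∧ θC ≤ dC k i ∧ ⌊Real.logb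 2 (1 / dC k i)⌋₊ = b.val), pC k i) (hρc' : ∀ i b, ρc' i b = ∑ k ∈ Finset.univ.filter (fun k => k ∉ (∅ : Finset (Fin n)) ∧ θC ≤ dC k i ∧ ⌊Real.logb 2 (1 / dC k i)⌋₊ = b.val), dC k i) (hyc : ∀ i b, yc i b = max (((Finset.univ.filter (fun k => k ∉ (∅ : Finset (Fin n)) ∧ θC ≤ dC k i ∧ ⌊Real.logb 2 (1 / dC k i)⌋₊ = b.val)).card : ℝ)) 1) (Ψc : Fin n → Fin m → Fin m → ℝ) : (((∑ k ∈ R, ∑ a, if ε₁ ≤ σ k a ∧ ∃ b, ε₁ ≤ ρ k b ∧ Ψ k a b ≤ (1 - ε₂) * (σ k a * ρ k b) / n then σ' k a * (1 - Real.log (x k a) / Real.log n) else 0) + (∑ i ∈ Q, ∑ a, if ε₁ ≤ σc i a ∧ ∃ b, ε₁ ≤ ρc i b ∧ Ψc i a b ≤ (1 - ε₂) * (σc i a * ρc i b) / n then σc' i a * (1 - Real.log (xc i a) / Real.log n) else 0) + (∑ k ∈ R, ∑ b, if ε₁ ≤ ρ k b ∧ ∃ a, ε₁ ≤ σ k a ∧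 Ψ k a b ≤ (1 - ε₂) * (σ k a * ρ k b) / n then ρ' k b * (1 - Real.log (y k b) / Real.log n) else 0) + (∑ i ∈ Q, ∑ b, if ε₁ ≤ ρc i b ∧ ∃ a, ε₁ ≤ σc i a ∧ Ψc i a b ≤ (1 - ε₂) * (σc i a * ρc i b) / n then ρc' i b * (1 - Real.log (yc i b) / Real.log n) else 0)) * Real.log n ≤ Real.log ((n.factorial : ℝ) / (S.card * T.card : ℕ)) + Real.log ((n.factorial : ℝ) / (T.card * U.card : ℕ)) + Real.log ((n.factorial : ℝ) / (U.card * S.card : ℕ)) + (((∑ k ∈ R, ∑ a, if ε₁ ≤ σ k a ∧ ∃ b, ε₁ ≤ ρ k b ∧ Ψ k a b ≤ (1 - ε₂) * (σ k a * ρ k b) / n then σ' k a else 0) + (∑ i ∈ Q, ∑ a, if ε₁ ≤ σc i a ∧ ∃ b, ε₁ ≤ ρc i b ∧ Ψc i a b ≤ (1 - ε₂) * (σc i a * ρc i b) / n then σc' i a else 0) + (∑ k ∈ R, ∑ b, if ε₁ ≤ ρ k b ∧ ∃ a, ε₁ ≤ σ k a ∧ Ψ k a b ≤ (1 - ε₂)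 * (σ k a * ρ k b) / n then ρ' k b else 0) + (∑ i ∈ Q, ∑ b, if ε₁ ≤ ρc i b ∧ ∃ a, ε₁ ≤ σc i a ∧ Ψc i a b ≤ (1 - ε₂) * (σc i a * ρc i b) / n then ρc' i b else 0)) * Real.log ((2 * (R.card : ℝ) + 2 * (Q.card : ℝ) + 2) / ε₁) + 6)) ∧ 0 ≤ (∑ k ∈ R, ∑ a, if ε₁ ≤ σ k a ∧ ∃ b, ε₁ ≤ ρ k b ∧ Ψ k a b ≤ (1 - ε₂) * (σ k a * ρ k b) / n then σ' k a else 0) + (∑ i ∈ Q, ∑ a, if ε₁ ≤ σc i a ∧ ∃ b, ε₁ ≤ ρc i b ∧ Ψc i a b ≤ (1 - ε₂) * (σc i a * ρc i b) / n then σc' i a else 0) + (∑ k ∈ R, ∑ b, if ε₁ ≤ ρ k b ∧ ∃ a, ε₁ ≤ σ k a ∧ Ψ k a b ≤ (1 - ε₂) * (σ k a * ρ k b) / n then ρ' k b else 0) + (∑ i ∈ Q, ∑ b, if ε₁ ≤ ρc i b ∧ ∃ a, ε₁ ≤ σc i a ∧ Ψc i a b ≤ (1 - ε₂) * (σc i a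 * ρc i b) / n then ρc' i b else 0) ∧ (∑ k ∈ R, ∑ a, if ε₁ ≤ σ k a ∧ ∃ b, ε₁ ≤ ρ k b ∧ Ψ k a b ≤ (1 - ε₂) * (σ k a * ρ k b) / n then σ' k a else 0) + (∑ i ∈ Q, ∑ a, if ε₁ ≤ σc i a ∧ ∃ b, ε₁ ≤ ρc i b ∧ Ψc i a b ≤ (1 - ε₂) * (σc i a * ρc i b) / n then σc' i a else 0) + (∑ k ∈ R, ∑ b, if ε₁ ≤ ρ k b ∧ ∃ a, ε₁ ≤ σ k a ∧ Ψ k a b ≤ (1 - ε₂) * (σ k a * ρ k b) / n then ρ' k b else 0) + (∑ i ∈ Q, ∑ b, if ε₁ ≤ ρc i b ∧ ∃ a, ε₁ ≤ σc i a ∧ Ψc i a b ≤ (1 - ε₂) * (σc i a * ρc i b) / n then ρc' i b else 0) ≤ 2 * (R.card : ℝ) + 2 * (Q.card : ℝ) := by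
  classical
  /- (0) basic facts -/
  have hnR : (2 : ℝ) ≤ n := by exact_mod_cast hn
  have hn0 : (0 : ℝ) < n := by linarith
  have hlog0 : 0 < Real.log n := Real.log_pos (by linarith)
  have h16 : (0 : ℝ) < 16 / n := by positivity
  have h1n : (0 : ℝ) < 1 / n := by positivity
  have hTU0 : (0 : ℝ) < (T.card * U.card : ℕ) := by exact_mod_cast Nat.mul_pos hT0.card_pos hU0.card_pos
  have hST0 : (0 : ℝ) < (S.card * T.card : ℕ) := by exact_mod_cast Nat.mul_pos hS0.card_pos hT0.card_pos
  have hUS0 : (0 : ℝ) < (U.card * S.card : ℕ) := by exact_mod_cast Nat.mul_pos hU0.card_pos hS0.card_pos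
  have hdA0 : ∀ i j, 0 ≤ dA i j := fun i j => by rw [hdA]; positivity
  have hdB0 : ∀ j k, 0 ≤ dB j k := fun j k => by rw [hdB]; positivity
  have hdC0 : ∀ k i, 0 ≤ dC k i := fun k i => by rw [hdC]; positivity
  -- unit row and column sums of the profiles
  have hcolB : ∀ k, ∑ j, dB j k = 1 := fun k => by
    simp only [hdB]
    rw [← Finset.sum_div, ← Nat.cast_sum, sum_pairMarginal_fst T U k]
    exact div_self hTU0.ne'
  have hrowA : ∀ i, ∑ j, dA i j = 1 := fun i => by
    simp only [hdA]
    rw [← Finset.sum_div, ← Nat.cast_sum, sum_pairMarginal_snd S T i]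
    exact div_self hST0.ne'
  have hrowC : ∀ k, ∑ i, dC k i = 1 := fun k => by
    simp only [hdC]
    rw [← Finset.sum_div, ← Nat.cast_sum, sum_pairMarginal_snd U S k]
    exact div_self hUS0.ne'
  have hcolC : ∀ i, ∑ k, dC k i = 1 := fun i => by
    simp only [hdC]
    rw [← Finset.sum_div, ← Nat.cast_sum, sum_pairMarginal_fst U S i]
    exact div_self hUS0.ne'
  -- the kept parts are below the masses, which are non-negative with level sums at most one
  have hσle : ∀ k a, σ k a ≤ σ' k a := fun k a => by
    rw [hσ, hσ']
    refine Finset.sum_le_sum fun j hj => ?_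
    have h := (Finset.mem_filter.1 hj).2.1
    rw [hpB, if_pos h]
    linarith
  have hρle : ∀ k b, ρ k b ≤ ρ' k b := fun k b => by
    rw [hρ, hρ']
    refine Finset.sum_le_sum fun i hi => ?_
    have h := (Finset.mem_filter.1 hi).2.2.1
    rw [hpC, if_pos h]
    linarith
  have hσcle : ∀ i a, σc i a ≤ σc' i a := fun i a => by
    rw [hσc, hσc']
    refine Finset.sum_le_sum fun j hj => ?_
    have h := (Finset.mem_filter.1 hj).2.1
    rw [hpBc, if_pos h]
    linarith
  have hρcle : ∀ i b, ρc i b ≤ ρc' i b := fun i b => by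
    rw [hρc, hρc']
    refine Finset.sum_le_sum fun k hk => ?_
    have h := (Finset.mem_filter.1 hk).2.2.1
    rw [hpC, if_pos h]
    linarith
  have hσ'0 : ∀ k a, 0 ≤ σ' k a := fun k a => by
    rw [hσ']; exact Finset.sum_nonneg fun j _ => hdB0 j k
  have hρ'0 : ∀ k b, 0 ≤ ρ' k b := fun k b => by
    rw [hρ']; exact Finset.sum_nonneg fun i _ => hdC0 k i
  have hσc'0 : ∀ i a, 0 ≤ σc' i a := fun i a => by
    rw [hσc']; exact Finset.sum_nonneg fun j _ => hdA0 i j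
  have hρc'0 : ∀ i b, 0 ≤ ρc' i b := fun i b => by
    rw [hρc']; exact Finset.sum_nonneg fun k _ => hdC0 k i
  have hσ'1 : ∀ k, ∑ a, σ' k a ≤ 1 := fun k => by
    simp only [hσ']
    rw [← hcolB k]
    refine costs_sum_blocks_le (fun j => dB j k) (fun j => hdB0 j k) _ fun a b j hja hjb => ?_
    simp only [Finset.mem_filter, Finset.mem_univ, true_and] at hja hjb
    exact Fin.ext (hja.2.symm.trans hjb.2)
  have hρ'1 : ∀ k, ∑ b, ρ' k b ≤ 1 := fun k => by
    simp only [hρ']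
    rw [← hrowC k]
    refine costs_sum_blocks_le (fun i => dC k i) (fun i => hdC0 k i) _ fun a b i hia hib => ?_
    simp only [Finset.mem_filter, Finset.mem_univ, true_and] at hia hib
    exact Fin.ext (hia.2.2.symm.trans hib.2.2)
  have hσc'1 : ∀ i, ∑ a, σc' i a ≤ 1 := fun i => by
    simp only [hσc']
    rw [← hrowA i]
    refine costs_sum_blocks_le (fun j => dA i j) (fun j => hdA0 i j) _ fun a b j hja hjb => ?_
    simp only [Finset.mem_filter, Finset.mem_univ, true_and] at hja hjb
    exact Fin.ext (hja.2.symm.trans hjb.2)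
  have hρc'1 : ∀ i, ∑ b, ρc' i b ≤ 1 := fun i => by
    simp only [hρc']
    rw [← hcolC i]
    refine costs_sum_blocks_le (fun k => dC k i) (fun k => hdC0 k i) _ fun a b k hka hkb => ?_
    simp only [Finset.mem_filter, Finset.mem_univ, true_and] at hka hkb
    exact Fin.ext (hka.2.2.symm.trans hkb.2.2)
  -- few positions
  have hR2 : 2 * (R.card : ℝ) ^ 2 ≤ n := by
    have h0 : (0 : ℝ) ≤ Q.card := Nat.cast_nonneg _
    have h1 : (R.card : ℝ) ^ 2 ≤ ((R.card : ℝ) + Q.card) ^ 2 :=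
      pow_le_pow_left₀ (Nat.cast_nonneg _) (by linarith) 2
    linarith
  have hQ2 : 2 * (Q.card : ℝ) ^ 2 ≤ n := by
    have h0 : (0 : ℝ) ≤ R.card := Nat.cast_nonneg _
    have h1 : (Q.card : ℝ) ^ 2 ≤ ((R.card : ℝ) + Q.card) ^ 2 :=
      pow_le_pow_left₀ (Nat.cast_nonneg _) (by linarith) 2
    linarith
  /- (1) the T-costs of the rows: `certificate_levels` for the pair `(T, U)` at the positions `R` -/
  obtain ⟨IncT, hIncT⟩ : ∃ I : Finset (Fin n × Fin m), I = (R ×ˢ Finset.univ).filter (fun p => ε₁ ≤ σ p.1 p.2 ∧ ∃ b, ε₁ ≤ ρ p.1 b ∧ Ψ p.1 p.2 b ≤ (1 - ε₂) * (σ p.1 p.2 * ρ p.1 b) / n) := ⟨_, rfl⟩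
  have hIncTsub : IncT ⊆ R ×ˢ Finset.univ := hIncT ▸ Finset.filter_subset _ _
  have hmemT : ∀ p ∈ IncT, p.1 ∈ R ∧ ε₁ ≤ σ p.1 p.2 := fun p hp => by
    rw [hIncT, Finset.mem_filter, Finset.mem_product] at hp
    exact ⟨hp.1.1, hp.2.1⟩
  have hPT : 2 * ((IncT.image Prod.fst).card : ℝ) ^ 2 ≤ n := by
    have h1 : ((IncT.image Prod.fst).card : ℝ) ≤ R.card := by
      exact_mod_cast costs_card_image_fst_le R IncT fun p hp => (hmemT p hp).1
    have h2 := pow_le_pow_left₀ (Nat.cast_nonneg _) h1 2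
    linarith
  have hcertT := certificate_levels hn T U hT0 hU0 (injOn_quot_second hTPP hS0) dB hdB (16 / n) h16
    IncT ε₁ hε₁ (fun p hp => by rw [← hσ']; exact (hmemT p hp).2.trans (hσle p.1 p.2)) hPT
  simp only [← hσ', ← hx] at hcertT
  have hCT := costs_sum_ite_mul R (fun k a => ε₁ ≤ σ k a ∧ ∃ b, ε₁ ≤ ρ k b ∧ Ψ k a b ≤ (1 - ε₂) * (σ k a * ρ k b) / n)
    σ' (fun k a => Real.log (x k a)) hlog0.ne'
  have hMT := costs_sum_ite R (fun k a => ε₁ ≤ σ k a ∧ ∃ b, ε₁ ≤ ρ k b ∧ Ψ k a b ≤ (1 - ε₂) * (σ k a * ρ k b) / n) σ'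
  rw [← hIncT] at hCT hMT
  have hMT0 : 0 ≤ ∑ p ∈ IncT, σ' p.1 p.2 := Finset.sum_nonneg fun p _ => hσ'0 p.1 p.2
  have hMT1 : ∑ p ∈ IncT, σ' p.1 p.2 ≤ R.card := costs_atom_sum_le_card R IncT hIncTsub σ' hσ'0 hσ'1
  /- (2) the T-costs of the columns: `certificate_levels` for the pair `(T, S)` at the positions `Q` -/
  obtain ⟨IncTc, hIncTc⟩ : ∃ I : Finset (Fin n × Fin m), I = (Q ×ˢ Finset.univ).filter (fun q => ε₁ ≤ σc q.1 q.2 ∧ ∃ b, ε₁ ≤ ρc q.1 b ∧ Ψc q.1 q.2 b ≤ (1 - ε₂) * (σc q.1 q.2 * ρc q.1 b) / n) := ⟨_, rfl⟩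
  have hIncTcsub : IncTc ⊆ Q ×ˢ Finset.univ := hIncTc ▸ Finset.filter_subset _ _
  have hmemTc : ∀ q ∈ IncTc, q.1 ∈ Q ∧ ε₁ ≤ σc q.1 q.2 := fun q hq => by
    rw [hIncTc, Finset.mem_filter, Finset.mem_product] at hq
    exact ⟨hq.1.1, hq.2.1⟩
  have hPTc : 2 * ((IncTc.image Prod.fst).card : ℝ) ^ 2 ≤ n := by
    have h1 : ((IncTc.image Prod.fst).card : ℝ) ≤ Q.card := by
      exact_mod_cast costs_card_image_fst_le Q IncTc fun q hq => (hmemTc q hq).1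
    have h2 := pow_le_pow_left₀ (Nat.cast_nonneg _) h1 2
    linarith
  have hdAt := (reversed_profiles S T U dA dB dC hdA hdB hdC).2.1
  have hcertTc := certificate_levels hn T S hT0 hS0 (injOn_quot_second (tpp_reverse hTPP) hU0)
    (fun j i => dA i j) (fun j i => hdAt j i) (16 / n) h16 IncTc ε₁ hε₁
    (fun q hq => by rw [← hσc']; exact (hmemTc q hq).2.trans (hσcle q.1 q.2)) hPTc
  simp only [← hσc', ← hxc] at hcertTc
  rw [Nat.mul_comm T.card S.card] at hcertTc
  have hCTc := costs_sum_ite_mul Q (fun i a => ε₁ ≤ σc i a ∧ ∃ b, ε₁ ≤ ρc i b ∧ Ψc i a b ≤ (1 - ε₂) * (σc i a * ρc i b) / n)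
    σc' (fun i a => Real.log (xc i a)) hlog0.ne'
  have hMTc := costs_sum_ite Q (fun i a => ε₁ ≤ σc i a ∧ ∃ b, ε₁ ≤ ρc i b ∧ Ψc i a b ≤ (1 - ε₂) * (σc i a * ρc i b) / n) σc'
  rw [← hIncTc] at hCTc hMTc
  have hMTc0 : 0 ≤ ∑ q ∈ IncTc, σc' q.1 q.2 := Finset.sum_nonneg fun q _ => hσc'0 q.1 q.2
  have hMTc1 : ∑ q ∈ IncTc, σc' q.1 q.2 ≤ Q.card := costs_atom_sum_le_card Q IncTc hIncTcsub σc' hσc'0 hσc'1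
  /- (3) the S-costs of rows and columns at once: `certificate_mixed_blocks` on `S⁻¹U` -/
  obtain ⟨IncS, hIncS⟩ : ∃ I : Finset (Fin n × Fin m), I = (R ×ˢ Finset.univ).filter (fun p => ε₁ ≤ ρ p.1 p.2 ∧ ∃ a, ε₁ ≤ σ p.1 a ∧ Ψ p.1 a p.2 ≤ (1 - ε₂) * (σ p.1 a * ρ p.1 p.2) / n) := ⟨_, rfl⟩
  have hIncSsub : IncS ⊆ R ×ˢ Finset.univ := hIncS ▸ Finset.filter_subset _ _
  have hmemS : ∀ p ∈ IncS, p.1 ∈ R ∧ ε₁ ≤ ρ p.1 p.2 := fun p hp => by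
    rw [hIncS, Finset.mem_filter, Finset.mem_product] at hp
    exact ⟨hp.1.1, hp.2.1⟩
  obtain ⟨IncSc, hIncSc⟩ : ∃ I : Finset (Fin n × Fin m), I = (Q ×ˢ Finset.univ).filter (fun q => ε₁ ≤ ρc q.1 q.2 ∧ ∃ a, ε₁ ≤ σc q.1 a ∧ Ψc q.1 a q.2 ≤ (1 - ε₂) * (σc q.1 a * ρc q.1 q.2) / n) := ⟨_, rfl⟩
  have hIncScsub : IncSc ⊆ Q ×ˢ Finset.univ := hIncSc ▸ Finset.filter_subset _ _
  have hmemSc : ∀ q ∈ IncSc, q.1 ∈ Q ∧ ε₁ ≤ ρc q.1 q.2 := fun q hq => by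
    rw [hIncSc, Finset.mem_filter, Finset.mem_product] at hq
    exact ⟨hq.1.1, hq.2.1⟩
  have hPV : 2 * (((IncS.image Prod.fst).card : ℝ) + ((IncSc.image Prod.fst).card : ℝ)) ^ 2 ≤ n := by
    have h1 : ((IncS.image Prod.fst).card : ℝ) ≤ R.card := by
      exact_mod_cast costs_card_image_fst_le R IncS fun p hp => (hmemS p hp).1
    have h2 : ((IncSc.image Prod.fst).card : ℝ) ≤ Q.card := by
      exact_mod_cast costs_card_image_fst_le Q IncSc fun q hq => (hmemSc q hq).1
    have h0 : (0 : ℝ) ≤ ((IncS.image Prod.fst).card : ℝ) + ((IncSc.image Prod.fst).card : ℝ) :=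
      add_nonneg (Nat.cast_nonneg _) (Nat.cast_nonneg _)
    have h3 := pow_le_pow_left₀ h0 (add_le_add h1 h2) 2
    linarith
  -- the quotient set `A = S⁻¹U` and its profile `d i k = dC k i`
  have hinjSU := injOn_quot_outer hTPP hT0
  set A : Finset (Equiv.Perm (Fin n)) := Finset.image₂ (fun x y : Equiv.Perm (Fin n) => x⁻¹ * y) S U
  have hA0 : A.Nonempty := hS0.image₂ hU0
  have hAcard : A.card = S.card * U.card := card_image₂_of_injOn' hinjSU
  have hd : ∀ i j, (fun i k => dC k i) i j = ((A.filter fun a => a j = i).card : ℝ) / A.card := by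
    intro i j
    show dC j i = _
    rw [hdC j i, card_filter_prod_swap U S j i, Nat.mul_comm, ← hAcard,
      pairMarginal_eq_marginal_image₂ hinjSU i j]
  have hBrow : ∀ p q : Fin n × Fin m, p.1 = q.1 →
      ∀ i ∈ Finset.univ.filter (fun i => i ∉ Q ∧ θC ≤ dC p.1 i ∧ ⌊Real.logb 2 (1 / dC p.1 i)⌋₊ = p.2.val),
        i ∈ Finset.univ.filter (fun i => i ∉ Q ∧ θC ≤ dC q.1 i ∧ ⌊Real.logb 2 (1 / dC q.1 i)⌋₊ = q.2.val) →
          p = q := by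
    intro p q hpq i hip hiq
    simp only [Finset.mem_filter, Finset.mem_univ, true_and] at hip hiq
    rw [hpq] at hip
    exact Prod.ext hpq (Fin.ext (hip.2.2.symm.trans hiq.2.2))
  have hBcol : ∀ p q : Fin n × Fin m, p.1 = q.1 →
      ∀ k ∈ Finset.univ.filter (fun k => k ∉ (∅ : Finset (Fin n)) ∧ θC ≤ dC k p.1 ∧ ⌊Real.logb 2 (1 / dC k p.1)⌋₊ = p.2.val),
        k ∈ Finset.univ.filter (fun k => k ∉ (∅ : Finset (Fin n)) ∧ θC ≤ dC k q.1 ∧ ⌊Real.logb 2 (1 / dC k q.1)⌋₊ = q.2.val) →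
          p = q := by
    intro p q hpq k hkp hkq
    simp only [Finset.mem_filter, Finset.mem_univ, true_and] at hkp hkq
    rw [hpq] at hkp
    exact Prod.ext hpq (Fin.ext (hkp.2.2.symm.trans hkq.2.2))
  have hdisj : ∀ p ∈ IncS, ∀ q ∈ IncSc,
      q.1 ∉ Finset.univ.filter (fun i => i ∉ Q ∧ θC ≤ dC p.1 i ∧ ⌊Real.logb 2 (1 / dC p.1 i)⌋₊ = p.2.val) := by
    intro p _ q hq h
    simp only [Finset.mem_filter, Finset.mem_univ, true_and] at h
    exact h.1 (hmemSc q hq).1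
  have hcertS := certificate_mixed_blocks hn A hA0 (fun i k => dC k i) hd
    (fun p => Finset.univ.filter (fun i => i ∉ Q ∧ θC ≤ dC p.1 i ∧ ⌊Real.logb 2 (1 / dC p.1 i)⌋₊ = p.2.val))
    hBrow
    (fun q => Finset.univ.filter (fun k => k ∉ (∅ : Finset (Fin n)) ∧ θC ≤ dC k q.1 ∧ ⌊Real.logb 2 (1 / dC k q.1)⌋₊ = q.2.val))
    hBcol IncS IncSc ε₁ hε₁
    (fun p hp => by rw [← hρ']; exact (hmemS p hp).2.trans (hρle p.1 p.2))
    (fun q hq => by rw [← hρc']; exact (hmemSc q hq).2.trans (hρcle q.1 q.2))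
    hdisj hPV
  simp only [← hρ', ← hy, ← hρc', ← hyc] at hcertS
  rw [hAcard, Nat.mul_comm S.card U.card] at hcertS
  have hCS := costs_sum_ite_mul R (fun k b => ε₁ ≤ ρ k b ∧ ∃ a, ε₁ ≤ σ k a ∧ Ψ k a b ≤ (1 - ε₂) * (σ k a * ρ k b) / n)
    ρ' (fun k b => Real.log (y k b)) hlog0.ne'
  have hMS := costs_sum_ite R (fun k b => ε₁ ≤ ρ k b ∧ ∃ a, ε₁ ≤ σ k a ∧ Ψ k a b ≤ (1 - ε₂) * (σ k a * ρ k b) / n) ρ'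
  rw [← hIncS] at hCS hMS
  have hCSc := costs_sum_ite_mul Q (fun i b => ε₁ ≤ ρc i b ∧ ∃ a, ε₁ ≤ σc i a ∧ Ψc i a b ≤ (1 - ε₂) * (σc i a * ρc i b) / n)
    ρc' (fun i b => Real.log (yc i b)) hlog0.ne'
  have hMSc := costs_sum_ite Q (fun i b => ε₁ ≤ ρc i b ∧ ∃ a, ε₁ ≤ σc i a ∧ Ψc i a b ≤ (1 - ε₂) * (σc i a * ρc i b) / n) ρc'
  rw [← hIncSc] at hCSc hMSc
  have hMS0 : 0 ≤ ∑ p ∈ IncS, ρ' p.1 p.2 := Finset.sum_nonneg fun p _ => hρ'0 p.1 p.2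
  have hMS1 : ∑ p ∈ IncS, ρ' p.1 p.2 ≤ R.card := costs_atom_sum_le_card R IncS hIncSsub ρ' hρ'0 hρ'1
  have hMSc0 : 0 ≤ ∑ q ∈ IncSc, ρc' q.1 q.2 := Finset.sum_nonneg fun q _ => hρc'0 q.1 q.2
  have hMSc1 : ∑ q ∈ IncSc, ρc' q.1 q.2 ≤ Q.card := costs_atom_sum_le_card Q IncSc hIncScsub ρc' hρc'0 hρc'1
  /- (4) the junk terms `s log (s/ε₁) ≤ s log (Mx/ε₁)`, `Mx = 2|R| + 2|Q| + 2`, and assembly -/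
  have hjT := costs_mul_log_le_of_le hMT0
    (show ∑ p ∈ IncT, σ' p.1 p.2 ≤ 2 * (R.card : ℝ) + 2 * (Q.card : ℝ) + 2 by
      linarith [(Nat.cast_nonneg _ : (0 : ℝ) ≤ Q.card)]) hε₁
  have hjTc := costs_mul_log_le_of_le hMTc0
    (show ∑ q ∈ IncTc, σc' q.1 q.2 ≤ 2 * (R.card : ℝ) + 2 * (Q.card : ℝ) + 2 by
      linarith [(Nat.cast_nonneg _ : (0 : ℝ) ≤ R.card)]) hε₁
  have hjS := costs_mul_log_le_of_le (add_nonneg hMS0 hMSc0)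
    (show (∑ p ∈ IncS, ρ' p.1 p.2) + ∑ q ∈ IncSc, ρc' q.1 q.2 ≤ 2 * (R.card : ℝ) + 2 * (Q.card : ℝ) + 2 by
      linarith) hε₁
  rw [add_mul, add_mul, add_mul, hCT, hCTc, hCS, hCSc, hMT, hMTc, hMS, hMSc]
  refine ⟨?_, by linarith, by linarith⟩
  have e : ((∑ p ∈ IncT, σ' p.1 p.2) + (∑ q ∈ IncTc, σc' q.1 q.2) + (∑ p ∈ IncS, ρ' p.1 p.2) +
      ∑ q ∈ IncSc, ρc' q.1 q.2) * Real.log ((2 * (R.card : ℝ) + 2 * (Q.card : ℝ) + 2) / ε₁) =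
      (∑ p ∈ IncT, σ' p.1 p.2) * Real.log ((2 * (R.card : ℝ) + 2 * (Q.card : ℝ) + 2) / ε₁) +
      (∑ q ∈ IncTc, σc' q.1 q.2) * Real.log ((2 * (R.card : ℝ) + 2 * (Q.card : ℝ) + 2) / ε₁) +
      ((∑ p ∈ IncS, ρ' p.1 p.2) + ∑ q ∈ IncSc, ρc' q.1 q.2) *
        Real.log ((2 * (R.card : ℝ) + 2 * (Q.card : ℝ) + 2) / ε₁) := by ring
  rw [e]
  linarith [hcertT, hcertTc, hcertS, hjT, hjTc, hjS]

/-- **The four entropy costs of the 3/4 step against `log K_A + log K_B + log K_C`.**  For a TPP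
triple `(S, T, U)` with profiles `dA, dB, dC`, hub rows `R` (mask `Q`) and hub columns `Q` with
`2(|R| + |Q|)² ≤ n`, and level data `σ σ' x ρ ρ' y Ψ` (rows) and `σc σc' xc ρc ρc' yc Ψc` (columns =
rows of the reversed triple), the T-costs and S-costs of `rows_kept_le` for both families satisfy
`(costs) · log n ≤ log K_A + log K_B + log K_C + (included mass) · log ((2|R| + 2|Q| + 2)/ε₁) + 6`.
[folklore] -/
theorem costs_certified {n m : ℕ} (hn : 2 ≤ n) {S T U : Finset (Equiv.Perm (Fin n))} (hTPP : TripleProductProperty S T U) (hS0 : S.Nonempty) (hT0 : T.Nonempty) (hU0 : U.Nonempty) (dA dB dC pB pC pBc : Fin n → Fin n → ℝ) (hdA : ∀ i j, dA i j = (((S ×ˢ T).filter fun st => st.2 j = st.1 i).card : ℝ) / (S.card * T.card : ℕ)) (hdB : ∀ j k, dB j k = (((T ×ˢ U).filter fun tu => tu.2 k = tu.1 j).card : ℝ) / (T.card * U.card : ℕ)) (hdC : ∀ k i, dC k i = (((U ×ˢ S).filter fun us => us.2 i = us.1 k).card : ℝ) / (U.card * S.card : ℕ)) (θC : ℝ)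 (hpB : ∀ j k, pB j k = if 16 / (n : ℝ) ≤ dB j k then dB j k - 1 / n else 0) (hpC : ∀ k i, pC k i = if θC ≤ dC k i then dC k i - 1 / n else 0) (hpBc : ∀ j i, pBc j i = if 16 / (n : ℝ) ≤ dA i j then dA i j - 1 / n else 0) (ε₁ ε₂ : ℝ) (hε₁ : 0 < ε₁) (R Q : Finset (Fin n)) (hRQ : 2 * ((R.card : ℝ) + Q.card) ^ 2 ≤ n) (σ σ' x ρ ρ' y : Fin n → Fin m → ℝ) (hσ : ∀ k a, σ k a = ∑ j ∈ Finset.univ.filter (fun j => 16 / (n : ℝ) ≤ dB j k ∧ ⌊Real.logb 2 (1 / dB j k)⌋₊ = a.val), pB j k) (hσ' : ∀ k a, σ' k a = ∑ j ∈ Finset.univ.filter (fun j => 16 / (n : ℝ) ≤ dB j k ∧ ⌊Real.logb 2 (1 / dB j k)⌋₊ = a.val), dB j k) (hx : ∀ k a, x k a = max (((Finset.univ.filter (fun j => 16 / (n : ℝ) ≤ dB j k ∧ ⌊Real.logb 2 (1 / dB j k)⌋₊ = a.val)).card : ℝ)) 1) (hρ : ∀ k b, ρ k b = ∑ i ∈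 Finset.univ.filter (fun i => i ∉ Q ∧ θC ≤ dC k i ∧ ⌊Real.logb 2 (1 / dC k i)⌋₊ = b.val), pC k i) (hρ' : ∀ k b, ρ' k b = ∑ i ∈ Finset.univ.filter (fun i => i ∉ Q ∧ θC ≤ dC k i ∧ ⌊Real.logb 2 (1 / dC k i)⌋₊ = b.val), dC k i) (hy : ∀ k b, y k b = max (((Finset.univ.filter (fun i => i ∉ Q ∧ θC ≤ dC k i ∧ ⌊Real.logb 2 (1 / dC k i)⌋₊ = b.val)).card : ℝ)) 1) (Ψ : Fin n → Fin m → Fin m → ℝ) (σc σc' xc ρc ρc' yc : Fin n → Fin m → ℝ) (hσc : ∀ i a, σc i a = ∑ j ∈ Finset.univ.filter (fun j => 16 / (n : ℝ) ≤ dA i j ∧ ⌊Real.logb 2 (1 / dA i j)⌋₊ = a.val), pBc j i) (hσc' : ∀ i a, σc' i a = ∑ j ∈ Finset.univ.filter (fun j => 16 / (n : ℝ) ≤ dA i j ∧ ⌊Real.logb 2 (1 / dA i j)⌋₊ = a.val), dA i j) (hxc : ∀ i a, xc i a = max (((Finset.univ.filter (fun j => 16 / (n : ℝ) ≤ dA i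 j ∧ ⌊Real.logb 2 (1 / dA i j)⌋₊ = a.val)).card : ℝ)) 1) (hρc : ∀ i b, ρc i b = ∑ k ∈ Finset.univ.filter (fun k => k ∉ (∅ : Finset (Fin n)) ∧ θC ≤ dC k i ∧ ⌊Real.logb 2 (1 / dC k i)⌋₊ = b.val), pC k i) (hρc' : ∀ i b, ρc' i b = ∑ k ∈ Finset.univ.filter (fun k => k ∉ (∅ : Finset (Fin n)) ∧ θC ≤ dC k i ∧ ⌊Real.logb 2 (1 / dC k i)⌋₊ = b.val), dC k i) (hyc : ∀ i b, yc i b = max (((Finset.univ.filter (fun k => k ∉ (∅ : Finset (Fin n)) ∧ θC ≤ dC k i ∧ ⌊Real.logb 2 (1 / dC k i)⌋₊ = b.val)).card : ℝ)) 1) (Ψc : Fin n → Fin m → Fin m → ℝ) : ((∑ k ∈ R, ∑ a, if ε₁ ≤ σ k a ∧ ∃ b, ε₁ ≤ ρ k b ∧ Ψ k a b ≤ (1 - ε₂) * (σ k a * ρ k b) / n then σ' k a * (1 - Real.log (x k a) / Real.log n) else 0) + (∑ i ∈ Q, ∑ a, if ε₁ ≤ σc i a ∧ ∃ b, ε₁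 ≤ ρc i b ∧ Ψc i a b ≤ (1 - ε₂) * (σc i a * ρc i b) / n then σc' i a * (1 - Real.log (xc i a) / Real.log n) else 0) + (∑ k ∈ R, ∑ b, if ε₁ ≤ ρ k b ∧ ∃ a, ε₁ ≤ σ k a ∧ Ψ k a b ≤ (1 - ε₂) * (σ k a * ρ k b) / n then ρ' k b * (1 - Real.log (y k b) / Real.log n) else 0) + (∑ i ∈ Q, ∑ b, if ε₁ ≤ ρc i b ∧ ∃ a, ε₁ ≤ σc i a ∧ Ψc i a b ≤ (1 - ε₂) * (σc i a * ρc i b) / n then ρc' i b * (1 - Real.log (yc i b) / Real.log n) else 0)) * Real.log n ≤ Real.log ((n.factorial : ℝ) / (S.card * T.card : ℕ)) + Real.log ((n.factorial : ℝ) / (T.card * U.card : ℕ)) + Real.log ((n.factorial : ℝ) / (U.card * S.card : ℕ)) + (((∑ k ∈ R, ∑ a, if ε₁ ≤ σ k a ∧ ∃ b, ε₁ ≤ ρ k b ∧ Ψ k a b ≤ (1 - ε₂) * (σ k a * ρ k b) / n then σ' k a else 0) + (∑ i ∈ Q, ∑ a, if ε₁ ≤ σc i a ∧ ∃ b, ε₁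 ≤ ρc i b ∧ Ψc i a b ≤ (1 - ε₂) * (σc i a * ρc i b) / n then σc' i a else 0) + (∑ k ∈ R, ∑ b, if ε₁ ≤ ρ k b ∧ ∃ a, ε₁ ≤ σ k a ∧ Ψ k a b ≤ (1 - ε₂) * (σ k a * ρ k b) / n then ρ' k b else 0) + (∑ i ∈ Q, ∑ b, if ε₁ ≤ ρc i b ∧ ∃ a, ε₁ ≤ σc i a ∧ Ψc i a b ≤ (1 - ε₂) * (σc i a * ρc i b) / n then ρc' i b else 0)) * Real.log ((2 * (R.card : ℝ) + 2 * (Q.card : ℝ) + 2) / ε₁) + 6) :=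
  (costs_certified_with_mass hn hTPP hS0 hT0 hU0 dA dB dC pB pC pBc hdA hdB hdC θC hpB hpC hpBc ε₁ ε₂ hε₁ R Q hRQ σ σ' x ρ ρ' y hσ hσ' hx hρ hρ' hy Ψ σc σc' xc ρc ρc' yc hσc hσc' hxc hρc hρc' hyc Ψc).1

/-- **The four entropy costs, crude form.**  As `costs_certified`, with the included mass replaced by
its bound: for `ε₁ ≤ 1` the junk term is at most `(2|R| + 2|Q| + 2) log ((2|R| + 2|Q| + 2)/ε₁) + 6`.
[folklore] -/
theorem costs_certified_crude {n m : ℕ} (hn : 2 ≤ n) {S T U : Finset (Equiv.Perm (Fin n))} (hTPP : TripleProductProperty S T U) (hS0 : S.Nonempty) (hT0 : T.Nonempty) (hU0 : U.Nonempty) (dA dB dC pB pC pBc : Fin n → Fin n → ℝ) (hdA : ∀ i j, dA i j = (((S ×ˢ T).filter fun st => st.2 j = st.1 i).card : ℝ) / (S.card * T.card : ℕ)) (hdB : ∀ j k, dB j k = (((T ×ˢ U).filter fun tu => tu.2 k = tu.1 j).card : ℝ) / (T.card * U.card : ℕ)) (hdC : ∀ k i, dC k i = (((U ×ˢ S).filter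 fun us => us.2 i = us.1 k).card : ℝ) / (U.card * S.card : ℕ)) (θC : ℝ) (hpB : ∀ j k, pB j k = if 16 / (n : ℝ) ≤ dB j k then dB j k - 1 / n else 0) (hpC : ∀ k i, pC k i = if θC ≤ dC k i then dC k i - 1 / n else 0) (hpBc : ∀ j i, pBc j i = if 16 / (n : ℝ) ≤ dA i j then dA i j - 1 / n else 0) (ε₁ ε₂ : ℝ) (hε₁ : 0 < ε₁) (R Q : Finset (Fin n)) (hRQ : 2 * ((R.card : ℝ) + Q.card) ^ 2 ≤ n) (σ σ' x ρ ρ' y : Fin n → Fin m → ℝ) (hσ : ∀ k a, σ k a = ∑ j ∈ Finset.univ.filter (fun j => 16 / (n : ℝ) ≤ dB j k ∧ ⌊Real.logb 2 (1 / dB j k)⌋₊ = a.val), pB j k) (hσ' : ∀ k a, σ' k a = ∑ j ∈ Finset.univ.filter (fun j => 16 / (n : ℝ) ≤ dB j k ∧ ⌊Real.logb 2 (1 / dB j k)⌋₊ = a.val), dB j k) (hx : ∀ k a, x k a = max (((Finset.univ.filter (fun j => 16 / (n : ℝ) ≤ dB j k ∧ ⌊Real.logb 2 (1 / dB j k)⌋₊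 = a.val)).card : ℝ)) 1) (hρ : ∀ k b, ρ k b = ∑ i ∈ Finset.univ.filter (fun i => i ∉ Q ∧ θC ≤ dC k i ∧ ⌊Real.logb 2 (1 / dC k i)⌋₊ = b.val), pC k i) (hρ' : ∀ k b, ρ' k b = ∑ i ∈ Finset.univ.filter (fun i => i ∉ Q ∧ θC ≤ dC k i ∧ ⌊Real.logb 2 (1 / dC k i)⌋₊ = b.val), dC k i) (hy : ∀ k b, y k b = max (((Finset.univ.filter (fun i => i ∉ Q ∧ θC ≤ dC k i ∧ ⌊Real.logb 2 (1 / dC k i)⌋₊ = b.val)).card : ℝ)) 1) (Ψ : Fin n → Fin m → Fin m → ℝ) (σc σc' xc ρc ρc' yc : Fin n → Fin m → ℝ) (hσc : ∀ i a, σc i a = ∑ j ∈ Finset.univ.filter (fun j => 16 / (n : ℝ) ≤ dA i j ∧ ⌊Real.logb 2 (1 / dA i j)⌋₊ = a.val), pBc j i) (hσc' : ∀ i a, σc' i a = ∑ j ∈ Finset.univ.filter (fun j => 16 / (n : ℝ) ≤ dA i j ∧ ⌊Real.logb 2 (1 / dA i j)⌋₊ = a.val), dA i j) (hxc : ∀ i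 a, xc i a = max (((Finset.univ.filter (fun j => 16 / (n : ℝ) ≤ dA i j ∧ ⌊Real.logb 2 (1 / dA i j)⌋₊ = a.val)).card : ℝ)) 1) (hρc : ∀ i b, ρc i b = ∑ k ∈ Finset.univ.filter (fun k => k ∉ (∅ : Finset (Fin n)) ∧ θC ≤ dC k i ∧ ⌊Real.logb 2 (1 / dC k i)⌋₊ = b.val), pC k i) (hρc' : ∀ i b, ρc' i b = ∑ k ∈ Finset.univ.filter (fun k => k ∉ (∅ : Finset (Fin n)) ∧ θC ≤ dC k i ∧ ⌊Real.logb 2 (1 / dC k i)⌋₊ = b.val), dC k i) (hyc : ∀ i b, yc i b = max (((Finset.univ.filter (fun k => k ∉ (∅ : Finset (Fin n)) ∧ θC ≤ dC k i ∧ ⌊Real.logb 2 (1 / dC k i)⌋₊ = b.val)).card : ℝ)) 1) (Ψc : Fin n → Fin m → Fin m → ℝ) (hε₁1 : ε₁ ≤ 1) : ((∑ k ∈ R, ∑ a, if ε₁ ≤ σ k a ∧ ∃ b, ε₁ ≤ ρ k b ∧ Ψ k a b ≤ (1 - ε₂) * (σ k a * ρ k b) / n then σ' k a * (1 - Real.log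 (x k a) / Real.log n) else 0) + (∑ i ∈ Q, ∑ a, if ε₁ ≤ σc i a ∧ ∃ b, ε₁ ≤ ρc i b ∧ Ψc i a b ≤ (1 - ε₂) * (σc i a * ρc i b) / n then σc' i a * (1 - Real.log (xc i a) / Real.log n) else 0) + (∑ k ∈ R, ∑ b, if ε₁ ≤ ρ k b ∧ ∃ a, ε₁ ≤ σ k a ∧ Ψ k a b ≤ (1 - ε₂) * (σ k a * ρ k b) / n then ρ' k b * (1 - Real.log (y k b) / Real.log n) else 0) + (∑ i ∈ Q, ∑ b, if ε₁ ≤ ρc i b ∧ ∃ a, ε₁ ≤ σc i a ∧ Ψc i a b ≤ (1 - ε₂) * (σc i a * ρc i b) / n then ρc' i b * (1 - Real.log (yc i b) / Real.log n) else 0)) * Real.log n ≤ Real.log ((n.factorial : ℝ) / (S.card * T.card : ℕ)) + Real.log ((n.factorial : ℝ) / (T.card * U.card : ℕ)) + Real.log ((n.factorial : ℝ) / (U.card * S.card : ℕ)) + ((2 * (R.card : ℝ) + 2 * (Q.card : ℝ) + 2) * Real.log ((2 * (R.card : ℝ) + 2 * (Q.card : ℝ) + 2) / ε₁) + 6) :=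 by
  obtain ⟨h, h0, h1⟩ := costs_certified_with_mass hn hTPP hS0 hT0 hU0 dA dB dC pB pC pBc hdA hdB hdC θC hpB hpC hpBc ε₁ ε₂ hε₁ R Q hRQ σ σ' x ρ ρ' y hσ hσ' hx hρ hρ' hy Ψ σc σc' xc ρc ρc' yc hσc hσc' hxc hρc hρc' hyc Ψc
  have hR0 : (0 : ℝ) ≤ R.card := Nat.cast_nonneg _
  have hQ0 : (0 : ℝ) ≤ Q.card := Nat.cast_nonneg _
  have hL : 0 ≤ Real.log ((2 * (R.card : ℝ) + 2 * (Q.card : ℝ) + 2) / ε₁) :=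
    Real.log_nonneg (by rw [le_div_iff₀ hε₁]; linarith)
  have h2 := mul_le_mul_of_nonneg_right
    (h1.trans (by linarith : 2 * (R.card : ℝ) + 2 * (Q.card : ℝ) ≤ 2 * (R.card : ℝ) + 2 * (Q.card : ℝ) + 2)) hL
  linarith

end Summit.MatrixMultiplication.MatrixMultiplication.Theorems.PolynomialSlack
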